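import Summits.CriticalPhenomena.PercolationContinuityZ3.Theorems.PercBoundarySqueezeFreeBoxFatClusterMassJumpSplit
import Summits.CriticalPhenomena.PercolationContinuityZ3.Theorems.PercBoundarySqueezeFreeBoxFatClusterMassJumpReduction
import Summits.CriticalPhenomena.PercolationContinuityZ3.Theorems.PercBoundarySqueezeFreeBoxFatClusterMassGiantLRO
import Summits.CriticalPhenomena.PercolationContinuityZ3.Theorems.PercBoundarySqueezeFreeBoxFatClusterMassGiantPolyLRO
import Summits.CriticalPhenomena.PercolationContinuityZ3.Theorems.PercBoundarySqueezeFreeBoxFatClusterMassStubFiniteClusterTail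
import Summits.CriticalPhenomena.PercolationContinuityZ3.Theorems.PercPorousCriticalFiniteClusterVolumeTailSummitEquiv

/-!
# `Lines/registered.lean` (v3.1) — skeleton for crux `PercBoundarySqueeze.FreeBoxFatClusterMass`
(item stmt-CriticalPhenomena-6982 · route route-CriticalPhenomena-PercBoundarySqueeze · sub-problem
`PercolationContinuityZ3` · lead c1 prover-line-stmt-CriticalPhenomena-6982-c1-0, 2026-08-17; v2 = the JUMP split of the
planner's birth skeleton; v3 = the same composition with the excluded-middle case split on `0 < θ(p_c)` made
explicit, so that each registered stub carries exactly ONE branch of content)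

**Crux.** `FreeBoxFatClusterMass`: at `p = p_c(ℤ³)` there are `δ > 0`, `C` with, for every `R ≥ 1`,
`Σ_{x ∈ Λ_R} P(fat_R(x)) ≤ C · R^{3 − δ}`, `fat_R(x)` = "some finset `T` with `Nat.sqrt (R^3) ≤ #T` is joined to `x`
inside `Λ_R = box 3 R`".

**Composition (kernel-checked, tree theorems only).** By cases on `0 < θ(p_c)`:
* jump branch `0 < θ(p_c)`: a vertex with a fat in-box piece lies in the INFINITE cluster
  (`stub_giantFatMass_jump`, B_∞) or in a FINITE cluster of `≥ ⌊R^{3/2}⌋ ≥ R` vertices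
  (`stub_finiteClusterTail_jump`, A recentred): `freeBoxFatClusterMass_of_finiteClusterTail_of_giantFatMass` (p149170);
* orthodox branch `θ(p_c) = 0` (`percolationContinuityZ3_of_not_theta_pos`, p148583): B_∞ is vacuous
  (`giantFatMass_of_continuity`) and the crux is exactly A (`stub_finiteClusterTail_orthodox`):
  `freeBoxFatClusterMass_of_continuity_of_finiteClusterTail` (p149170).

**Status of the three stubs.**
* `stub_finiteClusterTail_jump` (`0 < θ(p_c) → A`): SOURCELESS. Its planned source, crux stmt-0943
  `PercDebrisSweep.FiniteClusterVolumeTail` (Kesten–Zhang at a percolating density; reduction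
  `finiteClusterTail_of_jump_of_finiteClusterVolumeTail`, p148549), is REFUTED in exactly this branch by the tree theorem
  `FiniteClusterVolumeTail.not_finiteClusterVolumeTail_of_theta_criticalProbI_pos : 0 < θ(p_c) → ¬ K` (strip density +
  cheap blocking at `p_c` from Barsky–Grimmett–Newman: finite clusters at a percolating `p_c` are fatter than every
  `exp(-c m^{2/3})`; file `Theorems/PercPorousCriticalFiniteClusterVolumeTailSummitEquiv.lean`, `K ↔ PercolationContinuityZ3`),
  so p148549 is ex falso (see §3). The jump-world lower bound `≈ exp(-ε s^{2/3}) ∀ ε` does not contradict a power law, so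
  the stub is not refuted; at `p > p_c` it is Kesten–Zhang 1990 + Grimmett–Marstrand (tree `Grimmett1999_thm_8_65`,
  hypothesis `p_c < p`, not instantiable at `p_c`); AT a percolating `p_c` nothing is in print (a same-`p` argument from
  `θ(p) > 0` alone would open `{θ > 0}` — barrier `SprinklingRenormalisation`). A weaker open statement that gives it:
  `0 < θ(p_c) → TailMomentsSummable (criticalProbI 3)` (stub `CriticalTailMoments` of crux stmt-6065's line). OPEN.
* `stub_finiteClusterTail_orthodox` (`θ(p_c) = 0 → A`, i.e. "`1/δ > 0` on ℤ³"): open in print for `3 ≤ d ≤ 6`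
  (Hutchcroft, Probab. Math. Phys. 1 (2020) Thm 1.1 ASSUMES `P_{p_c}(|K| ≥ n) ≤ C n^{-1/δ}`; only the lower bound
  `≥ c n^{-1/2}` of Aizenman–Barsky is known). NOT USED by the route: `HalfSpaceOneArmRate → (0 < θ(p_c) → crux) →
  PercolationContinuityZ3` (`percolationContinuityZ3_of_halfSpaceOneArmRate_of_jump`, p148583). Idle orthodox content of
  the unconditional item (restating 6982 as `0 < θ(p_c) → FreeBoxFatClusterMass` deletes this stub).
* `stub_giantFatMass_jump` (`0 < θ(p_c) → B_∞`): `crux ⟹ B_∞` (`giantFatMass_of_freeBoxFatClusterMass`, p148583) and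
  `PolyScaleLROOfTheta (0858) → B_∞ → PercolationContinuityZ3` (p149769), `LinearScaleLROOfTheta (0855) → B_∞ →
  PercolationContinuityZ3` (p149552): the stub — and therefore the crux itself — is CONJUNCT-EQUIVALENT modulo box
  long-range order at one polynomial scale `R^α`, `α < 2`, in a jump world (Cerf, Ann. Probab. 43 (2015) Thm 1.3 gives
  only `α = 16` for `d = 3`). Crux-sized: promote / re-line.

Layout: §0 the stub statements as name-keyed `Prop`s (`Sig.*`) · §1 the three registered stubs (the only `sorry`s)
· §2 the composition BY NAME · §3 definitional consistency and the status lemmas as `example`s.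
-/

noncomputable section

namespace Summit.CriticalPhenomena.PercolationContinuityZ3.Cruxes.FreeBoxFatClusterMass.Registered

open MeasureTheory
open Literature.Probability.Percolation Literature.Probability.LatticeModels
open Summit.CriticalPhenomena.PercolationContinuityZ3.FreeBoxFatClusterMassLine
open scoped Classical BigOperators

/-! ## §0 The statements, name-keyed -/

namespace Sig

/-- A — power-law upper tail of the FINITE critical cluster volume on `ℤ³`:
`∃ c₀ > 0, C: ∀ s ≥ 1, P_{p_c}(|C(0)| < ∞ ∧ s ≤ |C(0)|) ≤ C · s^{−c₀}`. [statement; open problem] -/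
def FiniteClusterTail : Prop :=
  ∃ c₀ C : ℝ, 0 < c₀ ∧ ∀ s : ℝ, 1 ≤ s →
    (bondPercolation (zdGraph 3) (criticalProbI 3)).real
      {ω | (openCluster ω (0 : Site 3)).Finite ∧ s ≤ ((openCluster ω (0 : Site 3)).ncard : ℝ)}
      ≤ C * s ^ (-c₀)

/-- B_∞ — fat in-box pieces of the INFINITE cluster carry polynomially sub-volume mass at `p_c(ℤ³)`:
`∃ δ > 0, C: ∀ R ≥ 1, Σ_{x ∈ Λ_R} P_{p_c}(fat_R(x) ∧ |C(x)| = ∞) ≤ C · R^{3−δ}`. [statement; open problem] -/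
def GiantFatMass : Prop :=
  ∃ δ C : ℝ, 0 < δ ∧ ∀ R : ℕ, 1 ≤ R →
    ∑ x ∈ box 3 R, (bondPercolation (zdGraph 3) (criticalProbI 3)).real
      {ω | (∃ T : Finset (Site 3), Nat.sqrt (R ^ 3) ≤ T.card ∧
          ∀ y ∈ T, ω ∈ openConnIn (↑(box 3 R) : Set (Site 3)) x y) ∧
        (openCluster ω x).Infinite}
      ≤ C * (R : ℝ) ^ ((3 : ℝ) - δ)

/-- The jump hypothesis `0 < θ_0(p_c(ℤ³))`. -/
def Jump : Prop := 0 < theta (zdGraph 3) (0 : Site 3) (criticalProbI 3)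

/-- Name-keyed statement of `stub_finiteClusterTail_orthodox`: `θ(p_c) = 0 → A`. [stub statement; open problem] -/
def stub_finiteClusterTail_orthodox : Prop := _root_.PercolationContinuityZ3 → FiniteClusterTail

/-- Name-keyed statement of `stub_finiteClusterTail_jump`: `0 < θ(p_c) → A`. [stub statement; open problem] -/
def stub_finiteClusterTail_jump : Prop := Jump → FiniteClusterTail

/-- Name-keyed statement of `stub_giantFatMass_jump`: `0 < θ(p_c) → B_∞`. [stub statement; open problem] -/
def stub_giantFatMass_jump : Prop := Jump → GiantFatMass

end Sig

/-! ## §1 Registered stubs (the only `sorry`s of the file) -/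

/-- **Stub A, orthodox branch — `θ(p_c) = 0 →` power-law upper tail of the finite critical cluster volume
on `ℤ³`** ("`1/δ > 0`"; open in print for `3 ≤ d ≤ 6`; idle for route `PercBoundarySqueeze`).
[stub statement; open problem] -/
theorem stub_finiteClusterTail_orthodox :
    _root_.PercolationContinuityZ3 →
      ∃ c₀ C : ℝ, 0 < c₀ ∧ ∀ s : ℝ, 1 ≤ s →
        (bondPercolation (zdGraph 3) (criticalProbI 3)).real
          {ω | (openCluster ω (0 : Site 3)).Finite ∧ s ≤ ((openCluster ω (0 : Site 3)).ncard : ℝ)}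
          ≤ C * s ^ (-c₀) := by
  sorry

/-- **Stub A, jump branch — `0 < θ(p_c) →` power-law upper tail of the finite critical cluster volume on
`ℤ³`** (Kesten–Zhang at a percolating `p_c`; ⟸ crux stmt-0943 by
`finiteClusterTail_of_jump_of_finiteClusterVolumeTail`). [stub statement; open problem] -/
theorem stub_finiteClusterTail_jump :
    0 < theta (zdGraph 3) (0 : Site 3) (criticalProbI 3) →
      ∃ c₀ C : ℝ, 0 < c₀ ∧ ∀ s : ℝ, 1 ≤ s →
        (bondPercolation (zdGraph 3) (criticalProbI 3)).real
          {ω | (openCluster ω (0 : Site 3)).Finite ∧ s ≤ ((openCluster ω (0 : Site 3)).ncard : ℝ)}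
          ≤ C * s ^ (-c₀) := by
  sorry

/-- **Stub B_∞, jump branch — `0 < θ(p_c) →` fat in-box pieces of the INFINITE cluster carry polynomially
sub-volume mass at `p_c(ℤ³)`** (conjunct-equivalent modulo box LRO at a polynomial scale `< 2` in a jump
world; crux-sized). [stub statement; open problem] -/
theorem stub_giantFatMass_jump :
    0 < theta (zdGraph 3) (0 : Site 3) (criticalProbI 3) →
      ∃ δ C : ℝ, 0 < δ ∧ ∀ R : ℕ, 1 ≤ R →
        ∑ x ∈ box 3 R, (bondPercolation (zdGraph 3) (criticalProbI 3)).real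
          {ω | (∃ T : Finset (Site 3), Nat.sqrt (R ^ 3) ≤ T.card ∧
              ∀ y ∈ T, ω ∈ openConnIn (↑(box 3 R) : Set (Site 3)) x y) ∧
            (openCluster ω x).Infinite}
          ≤ C * (R : ℝ) ^ ((3 : ℝ) - δ) := by
  sorry

/-! ## §2 Composition (kernel-checked, no `sorry`): the three stubs give the crux by name -/

/-- **`stub_finiteClusterTail_orthodox → stub_finiteClusterTail_jump → stub_giantFatMass_jump →
FreeBoxFatClusterMass`**, by excluded middle on `0 < θ(p_c)`: the jump branch is the tree theorem
`freeBoxFatClusterMass_of_finiteClusterTail_of_giantFatMass` (jump split, recentring, `|Λ_R| ≤ 27R³`,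
`δ = min δ_B c₀`); the orthodox branch is `freeBoxFatClusterMass_of_continuity_of_finiteClusterTail`
(B_∞ vacuous when `θ(p_c) = 0`). -/
theorem FreeBoxFatClusterMass_of (hAo : Sig.stub_finiteClusterTail_orthodox)
    (hAj : Sig.stub_finiteClusterTail_jump) (hBj : Sig.stub_giantFatMass_jump) :
    Summit.CriticalPhenomena.PercolationContinuityZ3.Theses.PercBoundarySqueeze.FreeBoxFatClusterMass := by
  by_cases hθ : 0 < theta (zdGraph 3) (0 : Site 3) (criticalProbI 3)
  · exact freeBoxFatClusterMass_of_finiteClusterTail_of_giantFatMass (hAj hθ) (hBj hθ)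
  · have h0 : _root_.PercolationContinuityZ3 := percolationContinuityZ3_of_not_theta_pos hθ
    exact freeBoxFatClusterMass_of_continuity_of_finiteClusterTail h0 (hAo h0)

/-! ## §3 Definitional consistency and status -/

/-- The registered stub `stub_finiteClusterTail_orthodox`, as spelled out, IS `Sig.stub_finiteClusterTail_orthodox`. -/
theorem finiteClusterTail_orthodox_registered : Sig.stub_finiteClusterTail_orthodox :=
  stub_finiteClusterTail_orthodox

/-- The registered stub `stub_finiteClusterTail_jump`, as spelled out, IS `Sig.stub_finiteClusterTail_jump`. -/
theorem finiteClusterTail_jump_registered : Sig.stub_finiteClusterTail_jump :=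
  stub_finiteClusterTail_jump

/-- The registered stub `stub_giantFatMass_jump`, as spelled out, IS `Sig.stub_giantFatMass_jump`. -/
theorem giantFatMass_jump_registered : Sig.stub_giantFatMass_jump := stub_giantFatMass_jump

/- The crux from the three registered stubs (an `example`, so no `sorry`-tainted proof of the crux
enters the environment). -/
example : Summit.CriticalPhenomena.PercolationContinuityZ3.Theses.PercBoundarySqueeze.FreeBoxFatClusterMass :=
  FreeBoxFatClusterMass_of stub_finiteClusterTail_orthodox stub_finiteClusterTail_jump stub_giantFatMass_jump

/- Status, against the `Sig` names (all from the tree, no `sorry`). -/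

/- The unconditional B_∞ of v2 is the jump stub plus the (proved) orthodox vacuity. -/
example (hBj : Sig.stub_giantFatMass_jump) : Sig.GiantFatMass := by
  by_cases hθ : 0 < theta (zdGraph 3) (0 : Site 3) (criticalProbI 3)
  · exact hBj hθ
  · exact giantFatMass_of_continuity (percolationContinuityZ3_of_not_theta_pos hθ)

/- The crux implies B_∞ (hence the jump stub). -/
example (h : Summit.CriticalPhenomena.PercolationContinuityZ3.Theses.PercBoundarySqueeze.FreeBoxFatClusterMass) :
    Sig.stub_giantFatMass_jump := fun _ => giantFatMass_of_freeBoxFatClusterMass h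

/- B_∞ (jump stub) is conjunct-strength modulo linear-scale box LRO (0855) … -/
example (hX : Summit.CriticalPhenomena.PercolationContinuityZ3.Theses.PercFiniteBoxLRO.LinearScaleLROOfTheta)
    (hBj : Sig.stub_giantFatMass_jump) : _root_.PercolationContinuityZ3 := by
  by_cases hθ : 0 < theta (zdGraph 3) (0 : Site 3) (criticalProbI 3)
  · exact percolationContinuityZ3_of_linearScaleLRO_of_giantFatMass hX (hBj hθ)
  · exact percolationContinuityZ3_of_not_theta_pos hθ

/- … and already modulo box LRO at every polynomial scale (0858); hence so is the crux. -/
example (hP : Summit.CriticalPhenomena.PercolationContinuityZ3.Theses.PercFiniteBoxLRO.PolyScaleLROOfTheta)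
    (hBj : Sig.stub_giantFatMass_jump) : _root_.PercolationContinuityZ3 := by
  by_cases hθ : 0 < theta (zdGraph 3) (0 : Site 3) (criticalProbI 3)
  · exact percolationContinuityZ3_of_polyScaleLRO_of_giantFatMass hP (hBj hθ)
  · exact percolationContinuityZ3_of_not_theta_pos hθ

example (hP : Summit.CriticalPhenomena.PercolationContinuityZ3.Theses.PercFiniteBoxLRO.PolyScaleLROOfTheta)
    (h : Summit.CriticalPhenomena.PercolationContinuityZ3.Theses.PercBoundarySqueeze.FreeBoxFatClusterMass) :
    _root_.PercolationContinuityZ3 :=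
  percolationContinuityZ3_of_polyScaleLRO_of_giantFatMass hP (giantFatMass_of_freeBoxFatClusterMass h)

/- The jump stub A from crux stmt-0943 (p148549) … -/
example (hK : Summit.CriticalPhenomena.PercolationContinuityZ3.Theses.PercDebrisSweep.FiniteClusterVolumeTail) :
    Sig.stub_finiteClusterTail_jump := fun hθ => finiteClusterTail_of_jump_of_finiteClusterVolumeTail hθ hK

/- … is EX FALSO: in the jump branch 0943 is false (tree theorem, strip density + cheap blocking at `p_c`), so 0943 is no
source for `stub_finiteClusterTail_jump`; indeed 0943 ↔ the conjunct. -/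
example (hθ : Sig.Jump) : ¬ Summit.CriticalPhenomena.PercolationContinuityZ3.Theses.PercDebrisSweep.FiniteClusterVolumeTail :=
  fun hK => Summit.CriticalPhenomena.PercolationContinuityZ3.Theorems.FiniteClusterVolumeTail.not_finiteClusterVolumeTail_of_theta_criticalProbI_pos
    hθ (Summit.CriticalPhenomena.PercolationContinuityZ3.Theorems.FiniteClusterVolumeTail.percDebrisSweep_finiteClusterVolumeTail_iff_percolationContinuityZ3.1
      hK |> Summit.CriticalPhenomena.PercolationContinuityZ3.Theorems.FiniteClusterVolumeTail.finiteClusterVolumeTail_iff_percolationContinuityZ3.2)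

example : Summit.CriticalPhenomena.PercolationContinuityZ3.Theses.PercDebrisSweep.FiniteClusterVolumeTail ↔
    _root_.PercolationContinuityZ3 :=
  Summit.CriticalPhenomena.PercolationContinuityZ3.Theorems.FiniteClusterVolumeTail.percDebrisSweep_finiteClusterVolumeTail_iff_percolationContinuityZ3

/- The route needs only the two jump stubs (the orthodox stub is idle for `PercBoundarySqueeze`). -/
example (h1 : Summit.CriticalPhenomena.PercolationContinuityZ3.Theses.PercBoundarySqueeze.HalfSpaceOneArmRate)
    (hAj : Sig.stub_finiteClusterTail_jump) (hBj : Sig.stub_giantFatMass_jump) :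
    _root_.PercolationContinuityZ3 :=
  percolationContinuityZ3_of_halfSpaceOneArmRate_of_jump h1 fun hθ =>
    freeBoxFatClusterMass_of_finiteClusterTail_of_giantFatMass (hAj hθ) (hBj hθ)

end Summit.CriticalPhenomena.PercolationContinuityZ3.Cruxes.FreeBoxFatClusterMass.Registered

end
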